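import Literature.NumberTheory.Automorphic.UnitaryThreeAnisotropicStabilizerCosetForm    -- ★ FILE 2c (this seat): Lagrange, `σD·D = 1`
import HarnessLib

/-!
# Residue data for `Stab(w₀) ⧸ H′_m`: the `q∕s`-class, the canonical `σ`-fixed unit vector over a class, norm-one adjustment, and `N(ι) ≡ 1 (mod 𝔭^{2m+1})`
# (Flicker 1998, Prop. 16 p. 96 — LAYER B′ step 2, FILE 2e-α)

Topic `NumberTheory/Automorphic`; namespace `Literature.NumberTheory.Automorphic.UnitaryGroup`.  THEOREMS ONLY (no `def`, no instance, no notation, no named fact, no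
`sorry`; count-neutral).  Cell `pub/hodgecm-mathlib`, F0∕P3a road «D-N7-inert», line «N7nsCount» ((F11-c) `stub_irredGValueNeg`); LAYER B′ (design pen + cutting hand
A-p13 (g30), LEAD F0P3a-plan (g9) 2026-09-01T06:2xZ).  These are the valued-field lemmas the `Nat.card (S ⧸ H′_m) = (q+1)q^{4m}` transfer (FILE 2e-β, over ★ B-p10
p841656) consumes.  HONEST LABEL: HC_CM is proved only modulo the printed citations until rung 0 closes.

THE MATHEMATICS (`hd : LocalConjDatum σ ϖ`: `σ` an involution preserving `v`, `σϖ = ϖ`, `|2| = 1`, Hensel square roots of `1`-units).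
(§1) For `|s| = |s′| = 1`: `|q∕s − q′∕s′| ≤ |ϖ^m| ⟺ |s q′ − q s′| ≤ |ϖ^m|` — the first congruence of ★ FILE 2c is the class of `u = q∕s ∈ 𝒪` mod `𝔭^m`.
(§2) Every `u ∈ 𝒪` is `q∕s` for a unit vector: `s := √(1 + 4ϖN(u))⁻¹` `σ`-FIXED (★ `LocalConjDatum.exists_sqrt_fixed`), `q := u s` — so `π₁ : S⧸H′_m → 𝒪⧸𝔭^m` is onto
(with ★ FILE 2b-i).  (§3) NORM-ONE ADJUSTMENT: if `N(y) = σy·y` is a `1`-unit then `θ := y∕√N(y)` has `N(θ) = 1` and `|θ − y| ≤ |y|·|N(y) − 1|` — every residue class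
mod `𝔭^{2m+1}` of norm `≡ 1` contains an element of `E¹` (surjectivity of the fibre coordinate onto B-p10's norm-one residue set).  (§4) `N(ι) = 1 − 4ϖ·N(s q₀ − q s₀)` for
`ι = D·Φ(v, v₀)` with `σD·D = 1`, `v, v₀` unit vectors (★ `norm_form_add_norm_det`), so `|N(ι) − 1| ≤ |ϖ^{2m+1}|` on the fibre (`|s q₀ − q s₀| ≤ |ϖ^m|`).

## References
* [Flicker1998UnitaryFL] Y. Z. Flicker, *Elementary proof of the fundamental lemma for a unitary group*, Canad. J. Math. 50 (1998), Prop. 16 p. 96.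
* [Omeara1963] O. T. O'Meara, *Introduction to Quadratic Forms* (1963), §63A (63:1) (Hensel square roots), §11.
-/

set_option autoImplicit false

noncomputable section

open scoped MatrixGroups WithZero
open Matrix

namespace Literature.NumberTheory.Automorphic

namespace UnitaryGroup

open Literature.NumberTheory.Automorphic.HermitianLattice

variable {K : Type*} [Field K] [Valued K ℤᵐ⁰] {ϖ : K} (σ : K →+* K)

/-! ## §1 The `q∕s`-class -/

omit [Valued K ℤᵐ⁰] in
/-- `q∕s − q′∕s′ = (s′ q − q′ s)∕(s s′)` hence, for `|s| = |s′| = 1`, **`|q∕s − q′∕s′| = |s q′ − q s′|`**. [cite: Flicker1998UnitaryFL, Prop. 16 p. 96] -/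
theorem v_div_sub_div_eq [Valued K ℤᵐ⁰] {s s' q q' : K} (hs : Valued.v s = 1) (hs' : Valued.v s' = 1) :
    Valued.v (q / s - q' / s') = Valued.v (s * q' - q * s') := by
  have hs0 : s ≠ 0 := fun h0 => by rw [h0, map_zero] at hs; exact zero_ne_one hs
  have hs0' : s' ≠ 0 := fun h0 => by rw [h0, map_zero] at hs'; exact zero_ne_one hs'
  rw [div_sub_div _ _ hs0 hs0', map_div₀, map_mul, hs, hs', mul_one, div_one, show q * s' - s * q' = -(s * q' - q * s') by ring,
    Valuation.map_neg]

/-! ## §2 The canonical `σ`-fixed unit vector over `u ∈ 𝒪` -/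

/-- **EVERY `u ∈ 𝒪` IS `q∕s` FOR A UNIT VECTOR WITH `σ`-FIXED `s`**: `s := √(1 + 4ϖ·N(u))⁻¹` (★ `exists_sqrt_fixed`; `1 + 4ϖN(u)` is a `σ`-fixed `1`-unit), `q := u·s`:
`N(s) + 4ϖ·N(q) = s²(1 + 4ϖN(u)) = 1`, `|s| = 1`. [cite: Omeara1963, §63A (63:1)] [cite: Flicker1998UnitaryFL, Prop. 16 p. 96] -/
theorem exists_fixed_unit_vector (hd : LocalConjDatum σ ϖ) {u : K} (hu : Valued.v u ≤ 1) :
    ∃ s : K, σ s = s ∧ Valued.v s = 1 ∧ σ s * s + 4 * ϖ * (σ (u * s) * (u * s)) = 1 := by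
  have h4 : Valued.v (4 : K) = 1 := by rw [show (4 : K) = 2 * 2 by norm_num, map_mul, hd.v2, one_mul]
  have hϖ1 : Valued.v ϖ < 1 := by rw [hd.vϖ, ← WithZero.exp_zero]; exact WithZero.exp_lt_exp.2 (by norm_num)
  -- `w₀ := 1 + 4ϖ N(u)` is a `σ`-fixed `1`-unit
  have hsmall : Valued.v (4 * ϖ * (σ u * u)) < 1 := by
    rw [map_mul, map_mul, map_mul, h4, one_mul, hd.vσ]
    calc Valued.v ϖ * (Valued.v u * Valued.v u) ≤ Valued.v ϖ * (1 * 1) := mul_le_mul' le_rfl (mul_le_mul' hu hu)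
      _ = Valued.v ϖ := by rw [mul_one, mul_one]
      _ < 1 := hϖ1
  have hw₀ : Valued.v (1 + 4 * ϖ * (σ u * u)) = 1 := by
    rw [Valuation.map_add_eq_of_lt_left _ (by rw [Valuation.map_one]; exact hsmall), Valuation.map_one]
  have hw₀0 : 1 + 4 * ϖ * (σ u * u) ≠ 0 := fun h0 => by rw [h0, map_zero] at hw₀; exact zero_ne_one hw₀
  have hσw₀ : σ (1 + 4 * ϖ * (σ u * u)) = 1 + 4 * ϖ * (σ u * u) := by
    rw [map_add, map_one, map_mul, map_mul, map_mul, map_ofNat, hd.σϖ, hd.σσ, mul_comm (u) (σ u)]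
  -- its inverse `w` is a `σ`-fixed `1`-unit too
  have hw1 : Valued.v ((1 + 4 * ϖ * (σ u * u))⁻¹ - 1) < 1 := by
    have e : (1 + 4 * ϖ * (σ u * u))⁻¹ - 1 = -(4 * ϖ * (σ u * u)) / (1 + 4 * ϖ * (σ u * u)) := by
      rw [inv_eq_one_div, div_sub_one hw₀0]
      congr 1; ring
    rw [e, map_div₀, Valuation.map_neg, hw₀, div_one]
    exact hsmall
  have hσw : σ ((1 + 4 * ϖ * (σ u * u))⁻¹) = (1 + 4 * ϖ * (σ u * u))⁻¹ := by rw [map_inv₀, hσw₀]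
  obtain ⟨s, hs2, hσs, hs1, -, -⟩ := hd.exists_sqrt_fixed hw1 hσw
  have hvs : Valued.v s = 1 := by
    have e : s = 1 + (s - 1) := by ring
    rw [e, Valuation.map_add_eq_of_lt_left _ (by rw [Valuation.map_one]; exact hs1), Valuation.map_one]
  refine ⟨s, hσs, hvs, ?_⟩
  rw [map_mul, hσs]
  have e : s * s + 4 * ϖ * (σ u * s * (u * s)) = s ^ 2 * (1 + 4 * ϖ * (σ u * u)) := by ring
  rw [e, hs2, inv_mul_cancel₀ hw₀0]

/-! ## §3 Norm-one adjustment -/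

/-- **NORM-ONE ADJUSTMENT**: if `N(y) = σy·y` is a `1`-unit (`|N(y) − 1| < 1`) then there is `θ` with `N(θ) = 1` and `|θ − y| ≤ |y|·|N(y) − 1|` — `θ := y∕c`, `c = √N(y)`
`σ`-fixed with `|c − 1| = |N(y) − 1|` (`(c−1)(c+1) = N(y) − 1`, `|c + 1| = 1`).  So every class mod `𝔭^k` of norm `≡ 1` meets `E¹`. [cite: Omeara1963, §63A (63:1)] -/
theorem exists_norm_one_sub_le (hd : LocalConjDatum σ ϖ) {y : K} (hy : Valued.v (σ y * y - 1) < 1) :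
    ∃ θ : K, σ θ * θ = 1 ∧ Valued.v (θ - y) ≤ Valued.v y * Valued.v (σ y * y - 1) := by
  have hσN : σ (σ y * y) = σ y * y := by rw [map_mul, hd.σσ, mul_comm]
  obtain ⟨c, hc2, hσc, hc1, h1c, h1c0⟩ := hd.exists_sqrt_fixed hy hσN
  have hN0 : σ y * y ≠ 0 := by
    intro h0; rw [h0, zero_sub, Valuation.map_neg, Valuation.map_one] at hy; exact lt_irrefl _ hy
  have hc0 : c ≠ 0 := fun h0 => by rw [h0, zero_pow two_ne_zero] at hc2; exact hN0 hc2.symm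
  refine ⟨y / c, ?_, ?_⟩
  · rw [map_div₀, hσc, div_mul_div_comm, ← pow_two, hc2, div_self hN0]
  · -- `θ − y = −y (c − 1)∕c`, `|c − 1| = |N(y) − 1|∕|1 + c| = |N(y) − 1|`, `|c| = 1`
    have hvc : Valued.v c = 1 := by
      have e : c = 1 + (c - 1) := by ring
      rw [e, Valuation.map_add_eq_of_lt_left _ (by rw [Valuation.map_one]; exact hc1), Valuation.map_one]
    have hcm1 : Valued.v (c - 1) = Valued.v (σ y * y - 1) := by
      have e : σ y * y - 1 = (c - 1) * (1 + c) := by rw [← hc2]; ring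
      rw [e, map_mul, h1c, mul_one]
    have e : y / c - y = -(y * (c - 1)) / c := by field_simp; ring
    rw [e, map_div₀, Valuation.map_neg, map_mul, hvc, div_one, hcm1]

/-! ## §4 `N(ι) ≡ 1 (mod 𝔭^{2m+1})` for the fibrewise invariant -/

/-- **`σι·ι = 1 − 4ϖ·N(s q₀ − q s₀)`** for `ι = D·Φ(v, v₀)`, `σD·D = 1`, `v = (s,q)`, `v₀ = (s₀,q₀)` unit vectors (★ `norm_form_add_norm_det`), hence on the fibre
(`|s q₀ − q s₀| ≤ |ϖ^m|`) **`|σι·ι − 1| ≤ |ϖ^{2m+1}|`** — `ι` lands in B-p10 (g24)'s norm-`≡ 1` residue set mod `𝔭^{2m+1}` (★ p841656).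
[cite: Flicker1998UnitaryFL, Prop. 16 p. 96] [cite: Omeara1963, §11] -/
theorem v_norm_invariant_sub_one_le (hd : LocalConjDatum σ ϖ) (m : ℕ) {D s q s₀ q₀ : K} (hD : σ D * D = 1)
    (hv : σ s * s + 4 * ϖ * (σ q * q) = 1) (hv₀ : σ s₀ * s₀ + 4 * ϖ * (σ q₀ * q₀) = 1) (hclose : Valued.v (s * q₀ - q * s₀) ≤ Valued.v (ϖ ^ m)) :
    Valued.v (σ (D * (σ s * s₀ + 4 * ϖ * (σ q * q₀))) * (D * (σ s * s₀ + 4 * ϖ * (σ q * q₀))) - 1) ≤ Valued.v (ϖ ^ (2 * m + 1)) := by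
  have hL := norm_form_add_norm_det σ hd.σσ hd.σϖ s q s₀ q₀
  rw [hv, hv₀, mul_one] at hL
  have e : σ (D * (σ s * s₀ + 4 * ϖ * (σ q * q₀))) * (D * (σ s * s₀ + 4 * ϖ * (σ q * q₀))) - 1 =
      -(4 * ϖ * (σ (s * q₀ - q * s₀) * (s * q₀ - q * s₀))) := by
    rw [map_mul]
    linear_combination (σ (σ s * s₀ + 4 * ϖ * (σ q * q₀)) * (σ s * s₀ + 4 * ϖ * (σ q * q₀))) * hD + hL
  have h4 : Valued.v (4 : K) = 1 := by rw [show (4 : K) = 2 * 2 by norm_num, map_mul, hd.v2, one_mul]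
  rw [e, Valuation.map_neg, map_mul, map_mul, map_mul, h4, one_mul, hd.vσ,
    show ϖ ^ (2 * m + 1) = ϖ * (ϖ ^ m * ϖ ^ m) by ring, map_mul, map_mul]
  exact mul_le_mul' le_rfl (mul_le_mul' hclose hclose)

end UnitaryGroup

end Literature.NumberTheory.Automorphic

end
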